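import Literature.NumberTheory.EllipticCurves.PadicSigmaSqTwistTransportProofs
import Literature.NumberTheory.EllipticCurves.DivisionPolynomialFormalMulProofs
import Literature.NumberTheory.EllipticCurves.PadicSigmaSqDivisionTwo
import HarnessLib

/-!
# The squared duplication formula in the `x⁻¹`-variable: `w³·𝔖(ρ(w)) = 𝔖(w)⁴·N(w)` (proofs only)

Topic `Literature/NumberTheory/EllipticCurves` (trunk T-NT-EC). Pure proof file (no definition, no named
fact), sequel of `FormalInvXExpansionProofs.lean` (the `x⁻¹`-expansion `Σ = 𝔖(1/x)`),
`DivisionPolynomialFormalMulProofs.lean` (`ψₙ²(x(z))·x([n]z) = Φₙ(x(z))` on the formal group) and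
`PadicSigmaSqDivisionTwo.lean` / `SigmaSqDivisionOfThetaProofs.lean` (the squared `n`-division identity
`z^{2(n²−1)}Σ([n]z) = Σ(z)^{n²}·z^{2(n²−1)}ψₙ²(x(z))`). Width seat `bsd-line-cf2-p1-w5` (g20) of the cell
`bsd-print-cf2`, in support of stmt-BirchSwinnertonDyer-20368 (road (C); the `d = ±2` boundary of the
pinning stub `stub_pin_minusTwist_two`). BSD is not proved by any of this.

## The point

For a point `Q` of a `ℚ`-curve `V` over a RAMIFIED quadratic extension `L/ℚ₂` with `x(Q) ∈ ℚ` (the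
minus part of a quadratic twist), the parameter `z(Q) ∈ L` is not `2`-adically available in the tree's
`ℚ_p`-evaluation calculus, but `w = 1/x(Q) ∈ ℚ₂` is. The squared duplication formula
`Σ(2Q) = Σ(Q)⁴·ψ₂²(x(Q))` (Silverman 2005 (18) squared) therefore has to be rewritten as an identity of
ONE-variable series in `w`, which this file does:

* §1 `coeff_ΨSq_two`, `coeff_Φ_two`, `sum_ΨSq_two_eq` (`z⁶ψ₂²(x(z)) = X̂³·N(1/x)`), `sum_Φ_two_eq`
  (`z⁸Φ₂(x(z)) = X̂⁴·M(1/x)`) with `N(w) = 4 + b₂w + 2b₄w² + b₆w³`, `M(w) = 1 − b₄w² − 2b₆w³ − b₈w⁴`;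
* §2 `formalInvX_subst_formalMul_two` — **`(1/x)([2]z)·M(1/x(z)) = (1/x(z))·N(1/x(z))`**, i.e.
  `1/x(2Q) = ρ(1/x(Q))`, `ρ(w) = wN(w)/M(w) = ψ₂²/Φ₂` (any commutative ring);
* §3 `invXExpansion_duplication` — **`w³·𝔖(ρ(w)) = 𝔖(w)⁴·N(w)` in `ℚ_p⟦w⟧`** for every `x⁻¹`-expansion
  `Σ = 𝔖(1/x)` satisfying `SigmaSqDivisionIdentity Σ 2` (pull back both sides along `w = 1/x(z)` and use
  `IsInvXExpansion.unique`).

## Sources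

* J. H. Silverman, Math. Ann. 332 (2005), §5 Thm. 11 (18) and Rem. 2. [Silverman2005DivPoly]
* B. Mazur, J. Tate, Duke Math. J. 62 (1991), Thm. 3.1. [MazurTate1991]
* J. H. Silverman, *The Arithmetic of Elliptic Curves*, 2nd ed. (2009), III.2.3(d), Exercise 3.7(d), IV.1,
  IV.2.3. [SilvermanAEC2009]
-/

noncomputable section

open PowerSeries Literature.NumberTheory.EllipticCurves

namespace WeierstrassCurve

/-! ### §1 The duplication data `N(w) = w³ψ₂²(1/w)`, `M(w) = w⁴Φ₂(1/w)` read on the formal group -/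

section Ring

variable {R : Type*} [CommRing R] (W : WeierstrassCurve R)

/-- Coefficients of `ψ₂² = 4x³ + b₂x² + 2b₄x + b₆`. [cite: SilvermanAEC2009, Exercise 3.7] -/
theorem coeff_ΨSq_two :
    (W.ΨSq ((2 : ℕ) : ℤ)).coeff 0 = W.b₆ ∧ (W.ΨSq ((2 : ℕ) : ℤ)).coeff 1 = 2 * W.b₄ ∧
      (W.ΨSq ((2 : ℕ) : ℤ)).coeff 2 = W.b₂ ∧ (W.ΨSq ((2 : ℕ) : ℤ)).coeff 3 = 4 := by
  rw [Nat.cast_ofNat, WeierstrassCurve.ΨSq_two, WeierstrassCurve.Ψ₂Sq]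
  refine ⟨?_, ?_, ?_, ?_⟩ <;> simp [Polynomial.coeff_X, Polynomial.coeff_C]

/-- Coefficients of `Φ₂ = x⁴ − b₄x² − 2b₆x − b₈`. [cite: SilvermanAEC2009, Exercise 3.7] -/
theorem coeff_Φ_two :
    (W.Φ ((2 : ℕ) : ℤ)).coeff 0 = -W.b₈ ∧ (W.Φ ((2 : ℕ) : ℤ)).coeff 1 = -(2 * W.b₆) ∧
      (W.Φ ((2 : ℕ) : ℤ)).coeff 2 = -W.b₄ ∧ (W.Φ ((2 : ℕ) : ℤ)).coeff 3 = 0 ∧ (W.Φ ((2 : ℕ) : ℤ)).coeff 4 = 1 := by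
  rw [Nat.cast_ofNat, WeierstrassCurve.Φ_two]
  refine ⟨?_, ?_, ?_, ?_, ?_⟩ <;> simp [Polynomial.coeff_X, Polynomial.coeff_C]

/-- **`z⁶ψ₂²(x(z)) = X̂³·N(1/x)`** with `X̂ = z²x`, `N(w) = 4 + b₂w + 2b₄w² + b₆w³`: the squared
`2`-division polynomial read on the formal group is `x³N(1/x)`. [Silverman AEC Ex. 3.7(d); Silverman 2005
§1 Def. 1] [cite: SilvermanAEC2009, Exercise 3.7(d)] -/
theorem sum_ΨSq_two_eq :
    (∑ i ∈ Finset.range (2 ^ 2),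
        PowerSeries.C ((W.ΨSq ((2 : ℕ) : ℤ)).coeff i) * W.formalXMulSq ^ i * PowerSeries.X ^ (2 * (2 ^ 2 - 1 - i))) =
      W.formalXMulSq ^ 3 *
        (PowerSeries.C 4 + PowerSeries.C W.b₂ * W.formalInvX + PowerSeries.C (2 * W.b₄) * W.formalInvX ^ 2 +
          PowerSeries.C W.b₆ * W.formalInvX ^ 3) := by
  obtain ⟨h0, h1, h2, h3⟩ := W.coeff_ΨSq_two
  have hw := W.formalInvX_mul_formalXMulSq
  rw [show Finset.range (2 ^ 2) = Finset.range 4 by norm_num, Finset.sum_range_succ, Finset.sum_range_succ,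
    Finset.sum_range_succ, Finset.sum_range_succ, Finset.sum_range_zero, h0, h1, h2, h3]
  simp only [pow_zero, pow_one, mul_one, zero_add, Nat.reducePow, Nat.reduceSub, Nat.reduceMul]
  linear_combination (-(PowerSeries.C W.b₂ * W.formalXMulSq ^ 2 +
      PowerSeries.C (2 * W.b₄) * W.formalXMulSq * (W.formalInvX * W.formalXMulSq + PowerSeries.X ^ 2) +
      PowerSeries.C W.b₆ * ((W.formalInvX * W.formalXMulSq) ^ 2 +
        W.formalInvX * W.formalXMulSq * PowerSeries.X ^ 2 + PowerSeries.X ^ 4))) * hw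

/-- **`z⁸Φ₂(x(z)) = X̂⁴·M(1/x)`** with `M(w) = 1 − b₄w² − 2b₆w³ − b₈w⁴`. [Silverman AEC Ex. 3.7(d)]
[cite: SilvermanAEC2009, Exercise 3.7(d)] -/
theorem sum_Φ_two_eq :
    (∑ i ∈ Finset.range (2 ^ 2 + 1),
        PowerSeries.C ((W.Φ ((2 : ℕ) : ℤ)).coeff i) * W.formalXMulSq ^ i * PowerSeries.X ^ (2 * (2 ^ 2 - i))) =
      W.formalXMulSq ^ 4 *
        (1 - PowerSeries.C W.b₄ * W.formalInvX ^ 2 - PowerSeries.C (2 * W.b₆) * W.formalInvX ^ 3 -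
          PowerSeries.C W.b₈ * W.formalInvX ^ 4) := by
  obtain ⟨h0, h1, h2, h3, h4⟩ := W.coeff_Φ_two
  have hw := W.formalInvX_mul_formalXMulSq
  rw [show Finset.range (2 ^ 2 + 1) = Finset.range 5 by norm_num, Finset.sum_range_succ, Finset.sum_range_succ,
    Finset.sum_range_succ, Finset.sum_range_succ, Finset.sum_range_succ, Finset.sum_range_zero, h0, h1, h2,
    h3, h4]
  simp only [pow_zero, pow_one, mul_one, one_mul, zero_add, map_one, map_zero, zero_mul, add_zero, map_neg,
    neg_mul, Nat.reducePow, Nat.reduceSub, Nat.reduceMul]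
  linear_combination (PowerSeries.C W.b₄ * W.formalXMulSq ^ 2 * (W.formalInvX * W.formalXMulSq + PowerSeries.X ^ 2) +
      PowerSeries.C (2 * W.b₆) * W.formalXMulSq * ((W.formalInvX * W.formalXMulSq) ^ 2 +
        W.formalInvX * W.formalXMulSq * PowerSeries.X ^ 2 + PowerSeries.X ^ 4) +
      PowerSeries.C W.b₈ * ((W.formalInvX * W.formalXMulSq) ^ 3 +
        (W.formalInvX * W.formalXMulSq) ^ 2 * PowerSeries.X ^ 2 +
        W.formalInvX * W.formalXMulSq * PowerSeries.X ^ 4 + PowerSeries.X ^ 6)) * hw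

/-! ### §2 `1/x([2]z) = ρ(1/x(z))`, `ρ(w) = w·N(w)/M(w)` -/

/-- Substituting `1/x` into the polynomial `N = 4 + b₂X + 2b₄X² + b₆X³`. [folklore] -/
private theorem subst_N_formalInvX :
    (PowerSeries.C 4 + PowerSeries.C W.b₂ * PowerSeries.X + PowerSeries.C (2 * W.b₄) * PowerSeries.X ^ 2 +
        PowerSeries.C W.b₆ * PowerSeries.X ^ 3 : R⟦X⟧).subst W.formalInvX =
      PowerSeries.C 4 + PowerSeries.C W.b₂ * W.formalInvX + PowerSeries.C (2 * W.b₄) * W.formalInvX ^ 2 +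
        PowerSeries.C W.b₆ * W.formalInvX ^ 3 := by
  have hw := W.hasSubst_formalInvX
  have hC : ∀ a : R, (PowerSeries.C a).subst W.formalInvX = PowerSeries.C a := fun a => PowerSeries.subst_C a
  simp only [← coe_substAlgHom hw, map_add, map_mul, map_pow, substAlgHom_X]
  simp only [coe_substAlgHom hw, hC]

/-- Substituting `1/x` into the polynomial `M = 1 − b₄X² − 2b₆X³ − b₈X⁴`. [folklore] -/
private theorem subst_M_formalInvX :
    (1 - PowerSeries.C W.b₄ * PowerSeries.X ^ 2 - PowerSeries.C (2 * W.b₆) * PowerSeries.X ^ 3 -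
        PowerSeries.C W.b₈ * PowerSeries.X ^ 4 : R⟦X⟧).subst W.formalInvX =
      1 - PowerSeries.C W.b₄ * W.formalInvX ^ 2 - PowerSeries.C (2 * W.b₆) * W.formalInvX ^ 3 -
        PowerSeries.C W.b₈ * W.formalInvX ^ 4 := by
  have hw := W.hasSubst_formalInvX
  have hC : ∀ a : R, (PowerSeries.C a).subst W.formalInvX = PowerSeries.C a := fun a => PowerSeries.subst_C a
  simp only [← coe_substAlgHom hw, map_sub, map_one, map_mul, map_pow, substAlgHom_X]
  simp only [coe_substAlgHom hw, hC]

/-- **`1/x([2]z)·M(1/x(z)) = (1/x(z))·N(1/x(z))`**, i.e. `1/x(2Q) = ρ(1/x(Q))` with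
`ρ(w) = w·N(w)/M(w) = ψ₂²(x)/Φ₂(x)` read in `w = 1/x`: the duplication formula `x(2Q) = Φ₂(x)/ψ₂²(x)` on
the formal group (the tree's `sum_ΨSq_mul_formalXMulSq_subst_formalMul`, `n = 2`), any commutative ring.
[Silverman AEC III.2.3(d), Exercise 3.7(d), IV.2.3] [cite: SilvermanAEC2009, Exercise 3.7(d)] -/
theorem formalInvX_subst_formalMul_two :
    W.formalInvX.subst (W.formalMul 2) *
        (1 - PowerSeries.C W.b₄ * W.formalInvX ^ 2 - PowerSeries.C (2 * W.b₆) * W.formalInvX ^ 3 -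
          PowerSeries.C W.b₈ * W.formalInvX ^ 4) =
      W.formalInvX *
        (PowerSeries.C 4 + PowerSeries.C W.b₂ * W.formalInvX + PowerSeries.C (2 * W.b₄) * W.formalInvX ^ 2 +
          PowerSeries.C W.b₆ * W.formalInvX ^ 3) := by
  have h2s := W.hasSubst_formalMul 2
  have key := W.sum_ΨSq_mul_formalXMulSq_subst_formalMul 2
  rw [W.sum_ΨSq_two_eq, W.sum_Φ_two_eq] at key
  set N := PowerSeries.C 4 + PowerSeries.C W.b₂ * W.formalInvX + PowerSeries.C (2 * W.b₄) * W.formalInvX ^ 2 +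
    PowerSeries.C W.b₆ * W.formalInvX ^ 3 with hN
  set M := 1 - PowerSeries.C W.b₄ * W.formalInvX ^ 2 - PowerSeries.C (2 * W.b₆) * W.formalInvX ^ 3 -
    PowerSeries.C W.b₈ * W.formalInvX ^ 4 with hM
  set T₂ := W.formalMul 2 with hT₂
  set X₂ := W.formalXMulSq.subst T₂ with hX₂
  set w₂ := W.formalInvX.subst T₂ with hw₂
  have hXB : W.formalXMulSq * W.formalWDivCube = 1 := by rw [mul_comm]; exact W.formalWDivCube_mul_formalXMulSq
  have hw : W.formalInvX = PowerSeries.X ^ 2 * W.formalWDivCube := rfl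
  have hwX : w₂ * X₂ = T₂ ^ 2 := by
    rw [hw₂, hX₂, ← subst_mul h2s, formalInvX_mul_formalXMulSq, subst_pow h2s, PowerSeries.subst_X h2s]
  -- `X₂` is a unit
  have hX₂u : IsUnit X₂ := by
    rw [PowerSeries.isUnit_iff_constantCoeff, hX₂,
      Literature.RingTheory.FormalGroups.constantCoeff_subst_of_constantCoeff_eq_zero (W.constantCoeff_formalMul 2),
      constantCoeff_formalXMulSq]
    exact isUnit_one
  have hzero : (w₂ * M - W.formalInvX * N) * X₂ = 0 := by
    rw [hw]
    linear_combination (-(W.formalWDivCube ^ 4)) * key + M * hwX +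
      (((W.formalXMulSq * W.formalWDivCube) ^ 2 + W.formalXMulSq * W.formalWDivCube + 1) *
          (PowerSeries.X ^ 2 * W.formalWDivCube) * N * X₂ -
        ((W.formalXMulSq * W.formalWDivCube) ^ 3 + (W.formalXMulSq * W.formalWDivCube) ^ 2 +
          W.formalXMulSq * W.formalWDivCube + 1) * M * T₂ ^ 2) * hXB
  have := (hX₂u.mul_left_eq_zero).mp hzero
  exact sub_eq_zero.mp this

end Ring

/-! ### §3 The squared duplication formula for the `x⁻¹`-expansion `𝔖` -/

section Padic

variable {p : ℕ} [Fact p.Prime] (V : WeierstrassCurve ℚ_[p])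

variable {V} in
/-- **The squared duplication formula in the `x⁻¹`-variable.** If `Σ = 𝔖(1/x)` (`IsInvXExpansion`)
satisfies the squared `2`-division identity `z⁶·Σ([2]z) = Σ(z)⁴·z⁶ψ₂²(x(z))` (`SigmaSqDivisionIdentity Σ 2`;
every sigma-squared pair of a `p`-integral elliptic `V/ℚ_p` does, `sigmaSqDivisionIdentity_sq_of_satisfiesSigmaODE`),
then in `ℚ_p⟦w⟧`: **`w³·𝔖(ρ(w)) = 𝔖(w)⁴·N(w)`**, `ρ(w) = w·N(w)/M(w)`, `N = 4 + b₂w + 2b₄w² + b₆w³`,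
`M = 1 − b₄w² − 2b₆w³ − b₈w⁴` — Silverman's «`σ²(2Q) = σ(Q)⁸F₂²(Q)`» written through `1/x(Q)` and
`1/x(2Q) = ψ₂²/Φ₂`, an identity of ONE-variable series that can be evaluated at `w = 1/x(Q) ∈ ℚ_p` for
points `Q` over RAMIFIED extensions of `ℚ_p` with rational `x(Q)` (by `IsInvXExpansion.unique`).
[Silverman 2005, §5 Thm. 11 (18) and Rem. 2; Mazur–Tate 1991, Thm. 3.1; Silverman AEC Ex. 3.7(d)]
[cite: Silverman2005DivPoly, §5 Thm. 11 (18) and Rem. 2] [cite: SilvermanAEC2009, Exercise 3.7(d)] -/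
theorem invXExpansion_duplication {Sq S : ℚ_[p]⟦X⟧} (hS : V.IsInvXExpansion Sq S)
    (hdiv : V.SigmaSqDivisionIdentity Sq 2) :
    PowerSeries.X ^ 3 * S.subst (PowerSeries.X *
        (PowerSeries.C 4 + PowerSeries.C V.b₂ * PowerSeries.X + PowerSeries.C (2 * V.b₄) * PowerSeries.X ^ 2 +
          PowerSeries.C V.b₆ * PowerSeries.X ^ 3) *
        invOfUnit (1 - PowerSeries.C V.b₄ * PowerSeries.X ^ 2 - PowerSeries.C (2 * V.b₆) * PowerSeries.X ^ 3 -
          PowerSeries.C V.b₈ * PowerSeries.X ^ 4) 1) =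
      S ^ 4 * (PowerSeries.C 4 + PowerSeries.C V.b₂ * PowerSeries.X + PowerSeries.C (2 * V.b₄) * PowerSeries.X ^ 2 +
          PowerSeries.C V.b₆ * PowerSeries.X ^ 3) := by
  have hw := V.hasSubst_formalInvX
  have h2s := V.hasSubst_formalMul 2
  set NX : ℚ_[p]⟦X⟧ := PowerSeries.C 4 + PowerSeries.C V.b₂ * PowerSeries.X +
    PowerSeries.C (2 * V.b₄) * PowerSeries.X ^ 2 + PowerSeries.C V.b₆ * PowerSeries.X ^ 3 with hNX
  set MX : ℚ_[p]⟦X⟧ := 1 - PowerSeries.C V.b₄ * PowerSeries.X ^ 2 - PowerSeries.C (2 * V.b₆) * PowerSeries.X ^ 3 -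
    PowerSeries.C V.b₈ * PowerSeries.X ^ 4 with hMX
  set N := PowerSeries.C 4 + PowerSeries.C V.b₂ * V.formalInvX + PowerSeries.C (2 * V.b₄) * V.formalInvX ^ 2 +
    PowerSeries.C V.b₆ * V.formalInvX ^ 3 with hN
  set M := 1 - PowerSeries.C V.b₄ * V.formalInvX ^ 2 - PowerSeries.C (2 * V.b₆) * V.formalInvX ^ 3 -
    PowerSeries.C V.b₈ * V.formalInvX ^ 4 with hM
  have hNs : NX.subst V.formalInvX = N := V.subst_N_formalInvX
  have hMs : MX.subst V.formalInvX = M := V.subst_M_formalInvX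
  -- `M`, `MX` are units; the inverse substitutes to the inverse
  have hMX1 : PowerSeries.constantCoeff MX = 1 := by simp [hMX]
  have hMXinv : MX * invOfUnit MX 1 = 1 := mul_invOfUnit MX 1 (by rw [hMX1, Units.val_one])
  have hMinv : M * (invOfUnit MX 1).subst V.formalInvX = 1 := by
    rw [← hMs, ← subst_mul hw, hMXinv, ← coe_substAlgHom hw, map_one]
  have hMu : IsUnit M := IsUnit.of_mul_eq_one _ hMinv
  -- `ρ(1/x) = 1/x([2])`
  have hρ0 : PowerSeries.constantCoeff (PowerSeries.X * NX * invOfUnit MX 1) = 0 := by simp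
  have hρs : HasSubst (PowerSeries.X * NX * invOfUnit MX 1) := HasSubst.of_constantCoeff_zero' hρ0
  have hρ : (PowerSeries.X * NX * invOfUnit MX 1).subst V.formalInvX = V.formalInvX.subst (V.formalMul 2) := by
    have hA3 := V.formalInvX_subst_formalMul_two
    rw [← hM, ← hN] at hA3
    rw [subst_mul hw, subst_mul hw, PowerSeries.subst_X hw, hNs]
    apply hMu.mul_right_cancel
    rw [hA3, mul_assoc, mul_assoc, mul_comm _ M, hMinv, mul_one]
  -- both sides agree after `w ↦ 1/x(z)`
  have hXB : V.formalXMulSq * V.formalWDivCube = 1 := by rw [mul_comm]; exact V.formalWDivCube_mul_formalXMulSq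
  have hwdef : V.formalInvX = PowerSeries.X ^ 2 * V.formalWDivCube := rfl
  have hdiv' : PowerSeries.X ^ 6 * Sq.subst (V.formalMul 2) = Sq ^ 4 * (V.formalXMulSq ^ 3 * N) := by
    have := hdiv
    unfold SigmaSqDivisionIdentity sigmaSqDivisionRHS at this
    rw [V.sum_ΨSq_two_eq, show (2 : ℕ) ^ 2 = 4 from rfl, show 2 * (4 - 1) = 6 from rfl] at this
    rw [← hN] at this
    exact this
  have hSq := (V.isInvXExpansion_iff Sq S).mp hS
  have key : PowerSeries.subst V.formalInvX
        (PowerSeries.X ^ 3 * S.subst (PowerSeries.X * NX * invOfUnit MX 1) : ℚ_[p]⟦X⟧) =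
      PowerSeries.subst V.formalInvX (S ^ 4 * NX : ℚ_[p]⟦X⟧) := by
    rw [subst_mul hw, subst_pow hw, PowerSeries.subst_X hw, subst_comp_subst_apply hρs hw, hρ,
      ← subst_comp_subst_apply hw h2s, hSq, subst_mul hw, subst_pow hw, hSq, hNs, hwdef]
    linear_combination V.formalWDivCube ^ 3 * hdiv' +
      (((V.formalXMulSq * V.formalWDivCube) ^ 2 + V.formalXMulSq * V.formalWDivCube + 1) * Sq ^ 4 * N) * hXB
  have h1 : V.IsInvXExpansion (PowerSeries.subst V.formalInvX (S ^ 4 * NX : ℚ_[p]⟦X⟧))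
      (PowerSeries.X ^ 3 * S.subst (PowerSeries.X * NX * invOfUnit MX 1)) :=
    (V.isInvXExpansion_iff _ _).mpr key
  have h2 : V.IsInvXExpansion (PowerSeries.subst V.formalInvX (S ^ 4 * NX : ℚ_[p]⟦X⟧)) (S ^ 4 * NX) :=
    (V.isInvXExpansion_iff _ _).mpr rfl
  exact h1.unique h2

end Padic

end WeierstrassCurve
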